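import Literature.NumberTheory.ComplexMultiplication.ReflexNormArtinMap
import Literature.NumberTheory.NumberFields.ArtinKernelRayClassGroups
import HarnessLib

/-!
# Milne, *The fundamental theorem of complex multiplication* (2007), proof of Thm. 3.10, THE LAST STEP for the
# concrete `ι_E`: «`t = η(σ)/N_Φ(s)` lies in the common kernel of the maps `𝔸^×_{f,E}/E^× → C_m(E)` … As
# `t · ι_E t = 1`, `t = 1`» — hence `η(σ) ≡ N_Φ(s) (mod E^×)`

Layer `Literature/NumberTheory/ComplexMultiplication`; namespace `Literature.NumberTheory.ComplexMultiplication`.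
Lane `lit-hodgefound` (Track 2, Layer A3 skeleton seat `skel-3`, row A3-G42 FILE 2 of 2, the rider of
`…NumberFields/ArtinKernelRayClassGroups`).  THEOREMS ONLY, all proved; no definition, no named fact (D-0026, net
debt 0).  Inputs: FILE 1 (`⋂_𝔪 E^× · W_𝔪 = Ē`; for `E` CM and `ρ` acting as `ι_E` on `E^×`: `t ∈ Ē`, `t · ρ t = 1 ⇒
t ∈ E^×`) and `…ReflexNormArtinMap` §1 (`finiteIdeleComplexConj E = ι_E` on `(𝔸_{E,f})^×`, continuous, `= ι_E` on
`E^×`), §5 (`reflexNormFiniteClass`, `reflexNormFiniteClassOfGalois` = `σ ↦ N_{k,Φ}(s)_𝐡 · E^×`, `[s, k] = σ`).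

## The print, verbatim

J. S. Milne, *The fundamental theorem of complex multiplication*, arXiv:0705.3446 (2007), §3.4, proof of Thm. 3.10
(held text `paper:arxiv-0705.3446` p0017 L10–L22 and L60–L66):

> «Let `t = η(σ)/N_Φ(s)`. Then `t · ι_E t = 1/ac ∈ F_{≫0}`. […] Therefore we can write `ac = e · ι_E e` for some
> `e ∈ E^×`. Then `te · ι_E(te) = 1`. […] which implies that `t := η(σ)/N_Φ(s)` lies in the common kernel of the maps
> `𝔸^×_{f,E}/E^× → C_m(E)` for `m > 0`. But this common kernel is equal to the kernel of the Artin map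
> `𝔸^×_{f,E}/E^× → Gal(E^ab/E)`. As `t · ι_E t = 1` (see 3.12), `t = 1` (see 3.6).»

THEOREM 3.10 (= Milne CM Thm. 9.10) reads `η(σ) = N_Φ(s) mod E^×`.  Here: for a CM field `E` (`K` below), a CM type
`Φ`, a number field `k ⊆ ℂ` (⊇ `E*` where needed), `s ∈ 𝕀_k` and ANY finite idèle `θ ∈ (𝔸_{E,f})^×` — the
representative «`η(σ)·e`», a HYPOTHESIS (the geometric construction (e3) of `η` and the two inputs «`t` in the common
kernel» (Thm. 3.3 + [CFT, V 4.6]) and «`t · ι_E t = 1`» (Lemma 3.12, Hasse norm theorem) are NOT formalized here) —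
such that `t := θ / N_{k,Φ}(s)_𝐡` satisfies `t ∈ E^× · W_𝔪` for all `𝔪 ≠ 0` (resp. all `(m)`, `m > 0`; resp.
`[(1, t), E] = 1`) and `t · ι_E t = 1`, we conclude `θ ∈ N_{k,Φ}(s)_𝐡 · E^×`, i.e. `θ · E^× = N_{k,Φ}(s)_𝐡 · E^×`
`= reflexNormFiniteClassOfGalois σ` for `[s, k] = σ`.

* §1 FILE 1 §3–§4 for `ρ = ι_E = finiteIdeleComplexConj E`: `t ∈ Ē ∧ t · ι_E t = 1 ⇒ t ∈ E^×`
  (`mem_range_of_mem_topologicalClosure_of_mul_conj_eq_one`) and the three «common kernel» forms; «`t = 1`» in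
  `𝔸^×_{f,E}/E^×` (`mk_eq_one_of_forall_mem_sup_congruenceUnits_of_mul_conj_eq_one`).
* §2 THE ENDGAME: `exists_eq_finitePart_reflexNormIdele_mul_unitEmbedding` (`θ = N_{k,Φ}(s)_𝐡 · (e)`, `e ∈ E^×`),
  `mk_eq_reflexNormFiniteClass` (`θ · E^× = N_{k,Φ}(s)_𝐡 · E^×`), and with `[s, k] = σ`, `k ⊇ E*`:
  **`mk_eq_reflexNormFiniteClassOfGalois` (`θ · E^× = (σ ↦ N_Φ(s) · E^×)(σ)` — the displayed conclusion of Thm. 3.10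
  from its two number-theoretic inputs)**; the `m > 0` form `…_nat`.

NOT HERE (Layer B): Theorem 3.10 / 9.10 itself, `η` and (e3)/(64), Theorem 3.3, Lemma 3.12 = CM notes Lemma 9.14.

## References

* J. S. Milne, *The fundamental theorem of complex multiplication*, arXiv:0705.3446 (2007), §3.4, Thm. 3.10 and its
  proof (last paragraph), Lemma 3.6. [Milne2007FundamentalCM]
* J. S. Milne, *Complex Multiplication* (2006; version July 14, 2020), Ch. II §9, Thm. 9.10, Rem. 9.11 (a), proof
  pp. 79–80, Lemma 9.6. [MilneCM2006]

## Provenance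

Lane `lit-hodgefound`, seat `literature-prover-lit-hodgefound-skel-3-g27-0` (row A3-G42, FILE 2 of 2).
-/

set_option autoImplicit false

noncomputable section

open scoped NumberField

namespace Literature.NumberTheory.ComplexMultiplication

open Literature.AlgebraicGeometry.GaoUllmo2025
open Literature.AlgebraicGeometry.Motives (CMType)
open Literature.NumberTheory.GaloisRepresentations (ideleGroup)
open Literature.NumberTheory.NumberFields
open NumberField IsDedekindDomain Field

/-! ## §1. «As `t · ι_E t = 1`, `t = 1`» for `ι_E = finiteIdeleComplexConj E` -/

section Conj

variable (K : Type) [Field K] [NumberField K] [IsCMField K]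

/-- For a CM field `K`: `t ∈ Ē` (the closure of `K^×` in `(𝔸_{K,f})^×` = the kernel of the Artin map on
`𝔸^×_{f,K}/K^×`) and `t · ι_K t = 1` imply `t ∈ K^×` (FILE 1 §3 with `ρ = finiteIdeleComplexConj K`).
[cite: Milne2007FundamentalCM, §3.4, proof of Thm. 3.10 («As t·ι_E t = 1, t = 1 (see 3.6)»)] [cite: MilneCM2006, Ch. II §9, Lemma 9.6] -/
theorem mem_range_of_mem_topologicalClosure_of_mul_conj_eq_one {t : (FiniteAdeleRing (𝓞 K) K)ˣ}
    (ht : t ∈ (FiniteAdeleRing.unitEmbedding (𝓞 K) K).range.topologicalClosure)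
    (h1 : t * finiteIdeleComplexConj K t = 1) : t ∈ (FiniteAdeleRing.unitEmbedding (𝓞 K) K).range :=
  mem_range_of_mem_topologicalClosure_of_mul_map_eq_one K (finiteIdeleComplexConj K).toMonoidHom
    (continuous_finiteIdeleComplexConj K) (coe_finiteIdeleComplexConj_unitEmbedding K) ht h1

/-- **«`t` lies in the common kernel of the maps `𝔸^×_{f,E}/E^× → C_𝔪(E)` … As `t · ι_E t = 1`, `t = 1`»**:
`t ∈ K^× · W_𝔪` for every `𝔪 ≠ 0` and `t · ι_K t = 1` imply `t ∈ K^×`.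
[cite: Milne2007FundamentalCM, §3.4, proof of Thm. 3.10 (last paragraph)] [cite: MilneCM2006, Ch. II §9, proof of Thm. 9.10 (p. 80)] -/
theorem mem_range_of_forall_mem_sup_congruenceUnits_of_mul_conj_eq_one {t : (FiniteAdeleRing (𝓞 K) K)ˣ}
    (ht : ∀ 𝔪 : Ideal (𝓞 K), 𝔪 ≠ ⊥ →
      t ∈ (FiniteAdeleRing.unitEmbedding (𝓞 K) K).range ⊔ IdeleAction.congruenceUnits (K := K) 𝔪)
    (h1 : t * finiteIdeleComplexConj K t = 1) : t ∈ (FiniteAdeleRing.unitEmbedding (𝓞 K) K).range :=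
  mem_range_of_forall_mem_sup_congruenceUnits_of_mul_map_eq_one K (finiteIdeleComplexConj K).toMonoidHom
    (continuous_finiteIdeleComplexConj K) (coe_finiteIdeleComplexConj_unitEmbedding K) ht h1

/-- The `m > 0` form («`C_m(E)` for `m > 0`»): `t ∈ K^× · W_{(m)}` for every integer `m > 0` and `t · ι_K t = 1`
imply `t ∈ K^×`. [cite: Milne2007FundamentalCM, §3.4, proof of Thm. 3.10 (last paragraph)] -/
theorem mem_range_of_forall_nat_mem_sup_congruenceUnits_of_mul_conj_eq_one {t : (FiniteAdeleRing (𝓞 K) K)ˣ}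
    (ht : ∀ m : ℕ, m ≠ 0 →
      t ∈ (FiniteAdeleRing.unitEmbedding (𝓞 K) K).range ⊔
        IdeleAction.congruenceUnits (K := K) (Ideal.span {(m : 𝓞 K)}))
    (h1 : t * finiteIdeleComplexConj K t = 1) : t ∈ (FiniteAdeleRing.unitEmbedding (𝓞 K) K).range :=
  mem_range_of_forall_nat_mem_sup_congruenceUnits_of_mul_map_eq_one K (finiteIdeleComplexConj K).toMonoidHom
    (continuous_finiteIdeleComplexConj K) (coe_finiteIdeleComplexConj_unitEmbedding K) ht h1

/-- The ray-class-FIELD form: `[(1, t), K]|_{C_𝔪} = 1` for every `𝔪 ≠ 0` and `t · ι_K t = 1` imply `t ∈ K^×`.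
[cite: Milne2007FundamentalCM, §3.4, proof of Thm. 3.10 (last paragraph)] -/
theorem mem_range_of_forall_abRestrict_rayClassField_eq_one_of_mul_conj_eq_one {t : (FiniteAdeleRing (𝓞 K) K)ˣ}
    (ht : ∀ 𝔪 : Ideal (𝓞 K), 𝔪 ≠ ⊥ → abRestrict (rayClassField K 𝔪) (ideleArtinMap K
      (Units.map (N := AdeleRing (𝓞 K) K) (MonoidHom.inr (InfiniteAdeleRing K) (FiniteAdeleRing (𝓞 K) K)) t)) = 1)
    (h1 : t * finiteIdeleComplexConj K t = 1) : t ∈ (FiniteAdeleRing.unitEmbedding (𝓞 K) K).range :=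
  mem_range_of_forall_abRestrict_rayClassField_eq_one_of_mul_map_eq_one K (finiteIdeleComplexConj K).toMonoidHom
    (continuous_finiteIdeleComplexConj K) (coe_finiteIdeleComplexConj_unitEmbedding K) ht h1

/-- The Artin-kernel form («… equal to the kernel of the Artin map `𝔸^×_{f,E}/E^× → Gal(E^ab/E)`»):
`[(1, t), K] = 1` and `t · ι_K t = 1` imply `t ∈ K^×`. [cite: Milne2007FundamentalCM, §3.4, proof of Thm. 3.10 (last paragraph)] -/
theorem mem_range_of_ideleArtinMap_eq_one_of_mul_conj_eq_one {t : (FiniteAdeleRing (𝓞 K) K)ˣ}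
    (ht : ideleArtinMap K
      (Units.map (N := AdeleRing (𝓞 K) K) (MonoidHom.inr (InfiniteAdeleRing K) (FiniteAdeleRing (𝓞 K) K)) t) = 1)
    (h1 : t * finiteIdeleComplexConj K t = 1) : t ∈ (FiniteAdeleRing.unitEmbedding (𝓞 K) K).range :=
  mem_range_of_ideleArtinMap_eq_one_of_mul_map_eq_one K (finiteIdeleComplexConj K).toMonoidHom
    (continuous_finiteIdeleComplexConj K) (coe_finiteIdeleComplexConj_unitEmbedding K) ht h1

/-- **«`t = 1`» in `𝔸^×_{f,E}/E^×**: the class of `t` in `(𝔸_{K,f})^×/K^×` is trivial.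
[cite: Milne2007FundamentalCM, §3.4, proof of Thm. 3.10 («As t·ι_E t = 1 (see 3.12), t = 1 (see 3.6)»)] -/
theorem mk_eq_one_of_forall_mem_sup_congruenceUnits_of_mul_conj_eq_one {t : (FiniteAdeleRing (𝓞 K) K)ˣ}
    (ht : ∀ 𝔪 : Ideal (𝓞 K), 𝔪 ≠ ⊥ →
      t ∈ (FiniteAdeleRing.unitEmbedding (𝓞 K) K).range ⊔ IdeleAction.congruenceUnits (K := K) 𝔪)
    (h1 : t * finiteIdeleComplexConj K t = 1) :
    (QuotientGroup.mk t :
      (FiniteAdeleRing (𝓞 K) K)ˣ ⧸ (FiniteAdeleRing.unitEmbedding (𝓞 K) K).range) = 1 :=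
  (QuotientGroup.eq_one_iff t).mpr (mem_range_of_forall_mem_sup_congruenceUnits_of_mul_conj_eq_one K ht h1)

end Conj

/-! ## §2. The endgame: `θ ≡ N_{k,Φ}(s)_𝐡 (mod E^×)` -/

section Endgame

variable (K : Type) [Field K] [NumberField K] [IsCMField K] (Φ : CMType K)
  (k : IntermediateField ℚ ℂ) [NumberField k]

/-- **THE LAST STEP OF THE PROOF OF THM. 3.10, for the representative**: `E = K` a CM field, `s ∈ 𝕀_k`,
`θ ∈ (𝔸_{E,f})^×`; if `t := θ / N_{k,Φ}(s)_𝐡` lies in `E^× · W_𝔪` for every `𝔪 ≠ 0` («the common kernel of the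
maps `𝔸^×_{f,E}/E^× → C_m(E)`») and `t · ι_E t = 1`, then `θ = N_{k,Φ}(s)_𝐡 · (e)` for some `e ∈ E^×`.
[cite: Milne2007FundamentalCM, §3.4, Thm. 3.10 and its proof (last paragraph)] [cite: MilneCM2006, Ch. II §9, Thm. 9.10, proof pp. 79–80] -/
theorem exists_eq_finitePart_reflexNormIdele_mul_unitEmbedding (s : ideleGroup k)
    {θ : (FiniteAdeleRing (𝓞 K) K)ˣ}
    (hker : ∀ 𝔪 : Ideal (𝓞 K), 𝔪 ≠ ⊥ →
      θ * (IdeleAction.finitePart K (reflexNormIdele K Φ k s))⁻¹ ∈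
        (FiniteAdeleRing.unitEmbedding (𝓞 K) K).range ⊔ IdeleAction.congruenceUnits (K := K) 𝔪)
    (h1 : θ * (IdeleAction.finitePart K (reflexNormIdele K Φ k s))⁻¹ *
        finiteIdeleComplexConj K (θ * (IdeleAction.finitePart K (reflexNormIdele K Φ k s))⁻¹) = 1) :
    ∃ e : Kˣ, θ = IdeleAction.finitePart K (reflexNormIdele K Φ k s) * FiniteAdeleRing.unitEmbedding (𝓞 K) K e := by
  obtain ⟨e, he⟩ := mem_range_of_forall_mem_sup_congruenceUnits_of_mul_conj_eq_one K hker h1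
  exact ⟨e, by rw [← (eq_mul_inv_iff_mul_eq.mp he), mul_comm]⟩

/-- **`θ · E^× = N_{k,Φ}(s)_𝐡 · E^×`** in `𝔸^×_{f,E}/E^×` (the tree's `reflexNormFiniteClass K Φ k s`), under the
same two hypotheses. [cite: Milne2007FundamentalCM, §3.4, Thm. 3.10 and its proof (last paragraph)]
[cite: MilneCM2006, Ch. II §9, Thm. 9.10, Rem. 9.11 (a)] -/
theorem mk_eq_reflexNormFiniteClass (s : ideleGroup k) {θ : (FiniteAdeleRing (𝓞 K) K)ˣ}
    (hker : ∀ 𝔪 : Ideal (𝓞 K), 𝔪 ≠ ⊥ →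
      θ * (IdeleAction.finitePart K (reflexNormIdele K Φ k s))⁻¹ ∈
        (FiniteAdeleRing.unitEmbedding (𝓞 K) K).range ⊔ IdeleAction.congruenceUnits (K := K) 𝔪)
    (h1 : θ * (IdeleAction.finitePart K (reflexNormIdele K Φ k s))⁻¹ *
        finiteIdeleComplexConj K (θ * (IdeleAction.finitePart K (reflexNormIdele K Φ k s))⁻¹) = 1) :
    (QuotientGroup.mk θ :
        (FiniteAdeleRing (𝓞 K) K)ˣ ⧸ (FiniteAdeleRing.unitEmbedding (𝓞 K) K).range) =
      reflexNormFiniteClass K Φ k s := by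
  obtain ⟨e, hθ⟩ := exists_eq_finitePart_reflexNormIdele_mul_unitEmbedding K Φ k s hker h1
  rw [reflexNormFiniteClass_apply, QuotientGroup.eq, hθ, mul_inv_rev, inv_mul_cancel_right]
  exact inv_mem ⟨e, rfl⟩

/-- **MILNE 2007 THM. 3.10's DISPLAYED CONCLUSION `η(σ) = N_Φ(s) mod E^×` FROM ITS TWO NUMBER-THEORETIC INPUTS**:
for `k ⊇ E*`, `σ = [s, k] ∈ Gal(k^ab/k)` and a finite idèle `θ` of `E` («`η(σ)`», a hypothesis here) such that
`t := θ / N_{k,Φ}(s)_𝐡` lies in `E^× · W_𝔪` for every `𝔪 ≠ 0` and `t · ι_E t = 1`: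
`θ · E^× = (σ ↦ N_{k,Φ}(s)_𝐡 · E^×)(σ)` (the tree's `reflexNormFiniteClassOfGalois`, Rem. 9.11 (a)).  The geometric
`η`, Thm. 3.3 and Lemma 3.12 which supply the two inputs are NOT formalized (Layer B).
[cite: Milne2007FundamentalCM, §3.4, Thm. 3.10 and its proof (last paragraph)] [cite: MilneCM2006, Ch. II §9, Thm. 9.10, (64), Rem. 9.11 (a)] -/
theorem mk_eq_reflexNormFiniteClassOfGalois (hk : traceField Φ ≤ k) {σ : absoluteGaloisGroupAbelianization k}
    {s : ideleGroup k} (hs : ideleArtinMap k s = σ) {θ : (FiniteAdeleRing (𝓞 K) K)ˣ}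
    (hker : ∀ 𝔪 : Ideal (𝓞 K), 𝔪 ≠ ⊥ →
      θ * (IdeleAction.finitePart K (reflexNormIdele K Φ k s))⁻¹ ∈
        (FiniteAdeleRing.unitEmbedding (𝓞 K) K).range ⊔ IdeleAction.congruenceUnits (K := K) 𝔪)
    (h1 : θ * (IdeleAction.finitePart K (reflexNormIdele K Φ k s))⁻¹ *
        finiteIdeleComplexConj K (θ * (IdeleAction.finitePart K (reflexNormIdele K Φ k s))⁻¹) = 1) :
    (QuotientGroup.mk θ :
        (FiniteAdeleRing (𝓞 K) K)ˣ ⧸ (FiniteAdeleRing.unitEmbedding (𝓞 K) K).range) =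
      reflexNormFiniteClassOfGalois K Φ k hk σ := by
  rw [← hs, reflexNormFiniteClassOfGalois_ideleArtinMap, ← reflexNormFiniteClass_apply]
  exact mk_eq_reflexNormFiniteClass K Φ k s hker h1

/-- The same with the moduli `(m)`, `m > 0` («`C_m(E)` for `m > 0`», as printed).
[cite: Milne2007FundamentalCM, §3.4, Thm. 3.10 and its proof (last paragraph)] -/
theorem mk_eq_reflexNormFiniteClassOfGalois_nat (hk : traceField Φ ≤ k) {σ : absoluteGaloisGroupAbelianization k}
    {s : ideleGroup k} (hs : ideleArtinMap k s = σ) {θ : (FiniteAdeleRing (𝓞 K) K)ˣ}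
    (hker : ∀ m : ℕ, m ≠ 0 →
      θ * (IdeleAction.finitePart K (reflexNormIdele K Φ k s))⁻¹ ∈
        (FiniteAdeleRing.unitEmbedding (𝓞 K) K).range ⊔
          IdeleAction.congruenceUnits (K := K) (Ideal.span {(m : 𝓞 K)}))
    (h1 : θ * (IdeleAction.finitePart K (reflexNormIdele K Φ k s))⁻¹ *
        finiteIdeleComplexConj K (θ * (IdeleAction.finitePart K (reflexNormIdele K Φ k s))⁻¹) = 1) :
    (QuotientGroup.mk θ :
        (FiniteAdeleRing (𝓞 K) K)ˣ ⧸ (FiniteAdeleRing.unitEmbedding (𝓞 K) K).range) =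
      reflexNormFiniteClassOfGalois K Φ k hk σ := by
  refine mk_eq_reflexNormFiniteClassOfGalois K Φ k hk hs (fun 𝔪 h𝔪 => ?_) h1
  exact (mem_topologicalClosure_range_iff_forall_mem_sup_congruenceUnits K _).mp
    ((mem_topologicalClosure_range_iff_forall_nat K _).mpr hker) 𝔪 h𝔪

/-- The same from the Artin kernel: `[(1, t), E] = 1` and `t · ι_E t = 1` for `t := θ / N_{k,Φ}(s)_𝐡` imply
`θ · E^× = (σ ↦ N_{k,Φ}(s)_𝐡 · E^×)([s, k])`. [cite: Milne2007FundamentalCM, §3.4, Thm. 3.10 and its proof (last paragraph)] -/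
theorem mk_eq_reflexNormFiniteClassOfGalois_of_ideleArtinMap_eq_one (hk : traceField Φ ≤ k)
    {σ : absoluteGaloisGroupAbelianization k} {s : ideleGroup k} (hs : ideleArtinMap k s = σ)
    {θ : (FiniteAdeleRing (𝓞 K) K)ˣ}
    (hker : ideleArtinMap K (Units.map (N := AdeleRing (𝓞 K) K)
      (MonoidHom.inr (InfiniteAdeleRing K) (FiniteAdeleRing (𝓞 K) K))
        (θ * (IdeleAction.finitePart K (reflexNormIdele K Φ k s))⁻¹)) = 1)
    (h1 : θ * (IdeleAction.finitePart K (reflexNormIdele K Φ k s))⁻¹ *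
        finiteIdeleComplexConj K (θ * (IdeleAction.finitePart K (reflexNormIdele K Φ k s))⁻¹) = 1) :
    (QuotientGroup.mk θ :
        (FiniteAdeleRing (𝓞 K) K)ˣ ⧸ (FiniteAdeleRing.unitEmbedding (𝓞 K) K).range) =
      reflexNormFiniteClassOfGalois K Φ k hk σ := by
  refine mk_eq_reflexNormFiniteClassOfGalois K Φ k hk hs (fun 𝔪 h𝔪 => ?_) h1
  exact ((ideleArtinMap_units_map_inr_eq_one_iff_forall_mem_sup_congruenceUnits K _).mp hker) 𝔪 h𝔪

end Endgame

end Literature.NumberTheory.ComplexMultiplication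

end
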